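import Mathlib
import HarnessLib
import Summits.ResolutionOfSingularities.ResolutionOfSingularities.Theorems.WildQuotientsWildQuotientResolutionS1aChartRingGrading

/-!
# S1a — the lifted automorphism `σʼ` of the chart ring `R^w[(b T^d)⁻¹]`: graded, of order `p`, extending `σ ⊗ id_T`

[OURS · L1 W4.5c · lead-1 g6] — NOT a statement of the manuscript; counted 0; AI-level work, weaker than expert
review. Crux stmt-ResolutionOfSingularities-17941 (`WildQuotients.CyclicQuotientFourfolds`), line `s1a-logminvertex`,
stub `stub_localGame` (producer): the last two conjuncts of H3 `IsTameNode p (ChartRing …) 𝒜ʼ σʼ` and the two `σʼ`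
pins of `ChartClause` (`…S1aProducerStep` p572348), for the chart ring of H4a at a `σ`-INVARIANT cover element
`h = b T^d` (`σ b = b`; H3: «the σ-STABLE affine charts are the `D₊(h)` for `σ_T`-INVARIANT homogeneous `h`»).

Given a ring automorphism `σ` of `B` that is σ-ADAPTED to the centre (`σ(𝒥ₙ) ≤ 𝒥ₙ` for the weighted filtration)
and of finite order dividing `p > 0`:
* `sigmaT σ` — `σ ⊗ id_T` on `B[T;T⁻¹]` (Mathlib `AddMonoidAlgebra.mapRingEquiv`), `sigmaT_C_mul_T`, iterates;
* `sigmaT_mem` — `σ_T` preserves `R^w = ⊕ₙ 𝒥ₙ Tⁿ`; `sigmaR` — its restriction, a ring automorphism of `R^w`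
  (inverse = `σ_T^{p-1}`), with `sigmaR_coverElement` (`σ b = b ⇒ σ_R h = h`), `sigmaR_algebraMap`, `sigmaR_s`;
* `sigmaChart` — the induced automorphism `σʼ` of `R^w[h⁻¹]` (Mathlib `IsLocalization.ringEquivOfRingEquiv`), with the
  PINS `sigmaChart_algebraMap_algebraMap` (`σʼ` extends `σ` on `B`) and `sigmaChart_s` (`σʼ` fixes `T⁻¹`);
* `sigmaChart_mem_chartGrading` — `σʼ` is GRADED for the Rees bigrading `chartGrading` when `σ` is graded for `𝒜`;
* `sigmaChart_iterate` — `σʼ^[p] = id` when `σ^[p] = id`.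
-/

set_option linter.dupNamespace false

noncomputable section

open DirectSum Literature.AlgebraicGeometry.Resolution
open scoped LaurentPolynomial
open Summit.ResolutionOfSingularities.ResolutionOfSingularities.Theorems.WildQuotientResolution.S1.GradedLocalization
open Summit.ResolutionOfSingularities.ResolutionOfSingularities.Theorems.WildQuotientResolution.S1.ReesBigrading

namespace Summit.ResolutionOfSingularities.ResolutionOfSingularities.Theorems.WildQuotientResolution.S1.CoarseChart

universe u v

/-! ## `σ ⊗ id_T` on `B[T;T⁻¹]` -/

section SigmaT

variable {B : Type u} [CommRing B] (σ : B ≃+* B)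

/-- `σ_T := σ ⊗ id_T`, coefficientwise `σ` on Laurent polynomials. -/
def sigmaT : B[T;T⁻¹] ≃+* B[T;T⁻¹] :=
  AddMonoidAlgebra.mapRingEquiv ℤ σ

/-- Coefficients of `σ_T x`. -/
@[simp] theorem coeff_sigmaT (x : B[T;T⁻¹]) (m : ℤ) : (sigmaT σ x).coeff m = σ (x.coeff m) :=
  AddMonoidAlgebra.coeff_mapRingEquiv σ x m

/-- `σ_T (C x · Tⁿ) = C (σ x) · Tⁿ`. -/
theorem sigmaT_C_mul_T (x : B) (n : ℤ) :
    sigmaT σ (LaurentPolynomial.C x * LaurentPolynomial.T n) = LaurentPolynomial.C (σ x) * LaurentPolynomial.T n := by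
  rw [← LaurentPolynomial.single_eq_C_mul_T, ← LaurentPolynomial.single_eq_C_mul_T]
  exact AddMonoidAlgebra.mapRingEquiv_single σ x n

/-- Coefficients of the iterates `σ_T^[k] x`. -/
theorem coeff_sigmaT_iterate (k : ℕ) (x : B[T;T⁻¹]) (m : ℤ) :
    ((sigmaT σ)^[k] x).coeff m = (⇑σ)^[k] (x.coeff m) := by
  induction k generalizing x with
  | zero => rfl
  | succ k ih => rw [Function.iterate_succ_apply', Function.iterate_succ_apply', coeff_sigmaT, ih]

/-- `σ^[p] = id ⇒ σ_T^[p] = id`. -/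
theorem sigmaT_iterate_eq {p : ℕ} (hσp : ∀ x : B, (⇑σ)^[p] x = x) (x : B[T;T⁻¹]) : (sigmaT σ)^[p] x = x := by
  apply AddMonoidAlgebra.coeff_injective
  ext m
  rw [coeff_sigmaT_iterate, hσp]

/-- For `0 < p` and `σ_T^[p] = id`: `σ_T⁻¹ = σ_T^[p-1]`. -/
theorem sigmaT_symm_eq {p : ℕ} (hp : 0 < p) (hσp : ∀ x : B, (⇑σ)^[p] x = x) (x : B[T;T⁻¹]) :
    (sigmaT σ).symm x = (sigmaT σ)^[p - 1] x := by
  apply (sigmaT σ).injective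
  rw [RingEquiv.apply_symm_apply, ← Function.iterate_succ_apply' (sigmaT σ)]
  change x = (sigmaT σ)^[p - 1 + 1] x
  rw [Nat.sub_add_cancel hp, sigmaT_iterate_eq σ hσp]

end SigmaT

/-! ## `σ_R`: the restriction to the cobordant algebra -/

section SigmaR

variable {B : Type u} [CommRing B] (σ : B ≃+* B) {c : ℕ} (f : Fin c → B) (w : Fin c → ℕ)
  (hσJ : ∀ n : ℕ, ((weightedFiltration f w).ideal n).map (σ : B →+* B) ≤ (weightedFiltration f w).ideal n)

include hσJ in
/-- `σ`-adaptedness on the coefficient conditions. -/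
theorem coeffMem_sigma {m : ℤ} {a : B} (ha : (weightedFiltration f w).CoeffMem m a) :
    (weightedFiltration f w).CoeffMem m (σ a) :=
  fun n hn => hσJ n (Ideal.mem_map_of_mem _ (ha n hn))

include hσJ in
/-- **`σ_T` preserves `R^w`** (σ-adaptedness). -/
theorem sigmaT_mem {x : B[T;T⁻¹]} (hx : x ∈ cobordantAlgebra f w) : sigmaT σ x ∈ cobordantAlgebra f w := by
  rw [cobordantAlgebra_eq_extendedRees] at hx ⊢
  intro m
  rw [coeff_sigmaT]
  exact coeffMem_sigma σ f w hσJ (hx m)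

include hσJ in
/-- Hence so do its iterates. -/
theorem sigmaT_iterate_mem (k : ℕ) {x : B[T;T⁻¹]} (hx : x ∈ cobordantAlgebra f w) :
    (sigmaT σ)^[k] x ∈ cobordantAlgebra f w := by
  induction k with
  | zero => exact hx
  | succ k ih => rw [Function.iterate_succ_apply']; exact sigmaT_mem σ f w hσJ ih

variable {p : ℕ} (hp : 0 < p) (hσp : ∀ x : B, (⇑σ)^[p] x = x)

/-- **`σ_R`**: the ring automorphism of `R^w` induced by `σ_T` (its inverse is `σ_T^{p-1}`). [OURS · L1 W4.5c] -/
def sigmaR : ↥(cobordantAlgebra f w) ≃+* ↥(cobordantAlgebra f w) where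
  toFun x := ⟨sigmaT σ x, sigmaT_mem σ f w hσJ x.2⟩
  invFun x := ⟨(sigmaT σ).symm x, by
    rw [sigmaT_symm_eq σ hp hσp]; exact sigmaT_iterate_mem σ f w hσJ (p - 1) x.2⟩
  left_inv x := Subtype.ext ((sigmaT σ).symm_apply_apply x)
  right_inv x := Subtype.ext ((sigmaT σ).apply_symm_apply x)
  map_mul' x y := Subtype.ext (map_mul (sigmaT σ) (x : B[T;T⁻¹]) (y : B[T;T⁻¹]))
  map_add' x y := Subtype.ext (map_add (sigmaT σ) (x : B[T;T⁻¹]) (y : B[T;T⁻¹]))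

/-- Underlying Laurent polynomial of `σ_R x`. -/
@[simp] theorem coe_sigmaR (x : ↥(cobordantAlgebra f w)) :
    ((sigmaR σ f w hσJ hp hσp x : ↥(cobordantAlgebra f w)) : B[T;T⁻¹]) = sigmaT σ x :=
  rfl

/-- `σ_R` on the structure map: `σ_R (C x) = C (σ x)`. -/
theorem sigmaR_algebraMap (x : B) :
    sigmaR σ f w hσJ hp hσp (algebraMap B (↥(cobordantAlgebra f w)) x) =
      algebraMap B (↥(cobordantAlgebra f w)) (σ x) := by
  refine Subtype.ext ?_
  rw [coe_sigmaR, cobordantAlgebra.coe_algebraMap, cobordantAlgebra.coe_algebraMap]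
  have := sigmaT_C_mul_T σ x 0
  rwa [LaurentPolynomial.T_zero, mul_one, mul_one] at this

/-- `σ_R` fixes `s = T⁻¹`. -/
theorem sigmaR_s : sigmaR σ f w hσJ hp hσp (cobordantAlgebra.s f w) = cobordantAlgebra.s f w := by
  refine Subtype.ext ?_
  rw [coe_sigmaR, cobordantAlgebra.coe_s]
  have := sigmaT_C_mul_T σ 1 (-1)
  simp only [map_one, one_mul] at this
  exact this

/-- `σ_R` on a monomial `x Tⁿ ∈ R^w`. -/
theorem sigmaR_mk {x : B} {n : ℤ} (hmem : LaurentPolynomial.C x * LaurentPolynomial.T n ∈ cobordantAlgebra f w) :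
    sigmaR σ f w hσJ hp hσp ⟨_, hmem⟩ =
      ⟨LaurentPolynomial.C (σ x) * LaurentPolynomial.T n, by
        have := sigmaT_mem σ f w hσJ hmem; rwa [sigmaT_C_mul_T] at this⟩ :=
  Subtype.ext (sigmaT_C_mul_T σ x n)

/-- Iterates of `σ_R`. -/
theorem coe_sigmaR_iterate (k : ℕ) (x : ↥(cobordantAlgebra f w)) :
    (((sigmaR σ f w hσJ hp hσp)^[k] x : ↥(cobordantAlgebra f w)) : B[T;T⁻¹]) = (sigmaT σ)^[k] x := by
  induction k generalizing x with
  | zero => rfl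
  | succ k ih => rw [Function.iterate_succ_apply', Function.iterate_succ_apply', coe_sigmaR, ih]

/-- `σ_R^[p] = id`. -/
theorem sigmaR_iterate_eq (x : ↥(cobordantAlgebra f w)) : (sigmaR σ f w hσJ hp hσp)^[p] x = x :=
  Subtype.ext (by rw [coe_sigmaR_iterate, sigmaT_iterate_eq σ hσp])

end SigmaR

/-! ## `σʼ` on the chart ring -/

section SigmaChart

variable {ι : Type v} [AddCommGroup ι] [DecidableEq ι] {B : Type u} [CommRing B]
  (𝒜 : ι → AddSubgroup B) [GradedRing 𝒜] {c : ℕ} (f : Fin c → B) {δ : Fin c → ι} (w : Fin c → ℕ)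
  (hf : ∀ i, f i ∈ 𝒜 (δ i)) (d : ℕ) (b : ↥(𝒜 0)) (hb : b ∈ (traceFiltration 𝒜 f w).ideal d)
  (σ : B ≃+* B)
  (hσJ : ∀ n : ℕ, ((weightedFiltration f w).ideal n).map (σ : B →+* B) ≤ (weightedFiltration f w).ideal n)
  {p : ℕ} (hp : 0 < p) (hσp : ∀ x : B, (⇑σ)^[p] x = x) (hσb : σ (b : B) = b)

include hσb in
/-- `σ b = b ⇒ σ_R h = h` for the cover element `h = b T^d`. -/
theorem sigmaR_coverElement :
    sigmaR σ f w hσJ hp hσp (coverElement 𝒜 f w d b hb) = coverElement 𝒜 f w d b hb :=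
  Subtype.ext (by rw [coe_sigmaR, coe_coverElement, sigmaT_C_mul_T, hσb])

include hσb in
/-- The submonoid condition of `IsLocalization.ringEquivOfRingEquiv`. -/
theorem map_powers_coverElement :
    (Submonoid.powers (coverElement 𝒜 f w d b hb)).map (sigmaR σ f w hσJ hp hσp).toMonoidHom =
      Submonoid.powers (coverElement 𝒜 f w d b hb) := by
  rw [Submonoid.map_powers]
  exact congrArg _ (sigmaR_coverElement 𝒜 f w d b hb σ hσJ hp hσp hσb)

/-- **`σʼ`**: the automorphism of the chart ring `R^w[h⁻¹]` induced by `σ_R` (`σ_R h = h`). [OURS · L1 W4.5c] -/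
def sigmaChart : ChartRing 𝒜 f w d b hb ≃+* ChartRing 𝒜 f w d b hb :=
  IsLocalization.ringEquivOfRingEquiv (ChartRing 𝒜 f w d b hb) (ChartRing 𝒜 f w d b hb)
    (sigmaR σ f w hσJ hp hσp) (map_powers_coverElement 𝒜 f w d b hb σ hσJ hp hσp hσb)

/-- `σʼ` on the image of `R^w`. -/
theorem sigmaChart_algebraMap (z : ↥(cobordantAlgebra f w)) :
    sigmaChart 𝒜 f w d b hb σ hσJ hp hσp hσb (algebraMap _ (ChartRing 𝒜 f w d b hb) z) =
      algebraMap _ (ChartRing 𝒜 f w d b hb) (sigmaR σ f w hσJ hp hσp z) :=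
  IsLocalization.ringEquivOfRingEquiv_eq _ z

/-- **PIN**: `σʼ` extends `σ` on `B`. -/
theorem sigmaChart_algebraMap_algebraMap (x : B) :
    sigmaChart 𝒜 f w d b hb σ hσJ hp hσp hσb
        (algebraMap (↥(cobordantAlgebra f w)) (ChartRing 𝒜 f w d b hb)
          (algebraMap B (↥(cobordantAlgebra f w)) x)) =
      algebraMap (↥(cobordantAlgebra f w)) (ChartRing 𝒜 f w d b hb)
        (algebraMap B (↥(cobordantAlgebra f w)) (σ x)) := by
  rw [sigmaChart_algebraMap, sigmaR_algebraMap]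

/-- **PIN**: `σʼ` fixes `T⁻¹`. -/
theorem sigmaChart_s :
    sigmaChart 𝒜 f w d b hb σ hσJ hp hσp hσb
        (algebraMap (↥(cobordantAlgebra f w)) (ChartRing 𝒜 f w d b hb) (cobordantAlgebra.s f w)) =
      algebraMap (↥(cobordantAlgebra f w)) (ChartRing 𝒜 f w d b hb) (cobordantAlgebra.s f w) := by
  rw [sigmaChart_algebraMap, sigmaR_s]

/-- `σʼ` fixes `h⁻¹`. -/
theorem sigmaChart_invSelf :
    sigmaChart 𝒜 f w d b hb σ hσJ hp hσp hσb (IsLocalization.Away.invSelf (coverElement 𝒜 f w d b hb)) =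
      IsLocalization.Away.invSelf (coverElement 𝒜 f w d b hb) := by
  rw [IsLocalization.Away.invSelf, sigmaChart, IsLocalization.ringEquivOfRingEquiv_mk']
  congr 1
  · exact map_one _
  · exact Subtype.ext (sigmaR_coverElement 𝒜 f w d b hb σ hσJ hp hσp hσb)

/-- `σʼ` on a fraction `z / hᵐ`. -/
theorem sigmaChart_algebraMap_mul_invSelf_pow (z : ↥(cobordantAlgebra f w)) (m : ℕ) :
    sigmaChart 𝒜 f w d b hb σ hσJ hp hσp hσb
        (algebraMap _ (ChartRing 𝒜 f w d b hb) z * IsLocalization.Away.invSelf (coverElement 𝒜 f w d b hb) ^ m) =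
      algebraMap _ (ChartRing 𝒜 f w d b hb) (sigmaR σ f w hσJ hp hσp z) *
        IsLocalization.Away.invSelf (coverElement 𝒜 f w d b hb) ^ m := by
  rw [map_mul, map_pow, sigmaChart_algebraMap, sigmaChart_invSelf]

omit [AddCommGroup ι] [DecidableEq ι] [GradedRing 𝒜] in
/-- `σ` graded ⇒ `σ_R` bigraded. -/
theorem sigmaR_mem_reesPiece (hσ𝒜 : ∀ (i : ι) (x : B), x ∈ 𝒜 i → σ x ∈ 𝒜 i) {e : ℤ × ι}
    {z : ↥(cobordantAlgebra f w)} (hz : z ∈ reesPiece 𝒜 f w e) : sigmaR σ f w hσJ hp hσp z ∈ reesPiece 𝒜 f w e := by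
  obtain ⟨x, hx, hzx⟩ := hz
  exact ⟨σ x, hσ𝒜 _ x hx, by rw [coe_sigmaR, hzx, sigmaT_C_mul_T]⟩

/-- **`σʼ` is GRADED** for the Rees bigrading of the chart ring (given `σ` graded for `𝒜`). [OURS · L1 W4.5c] -/
theorem sigmaChart_mem_chartGrading (hσ𝒜 : ∀ (i : ι) (x : B), x ∈ 𝒜 i → σ x ∈ 𝒜 i) (e : ℤ × ι)
    (y : ChartRing 𝒜 f w d b hb) (hy : y ∈ chartGrading 𝒜 f w hf d b hb e) :
    sigmaChart 𝒜 f w d b hb σ hσJ hp hσp hσb y ∈ chartGrading 𝒜 f w hf d b hb e := by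
  obtain ⟨m, z, hz, rfl⟩ := (mem_chartGrading_iff 𝒜 f w hf d b hb).mp hy
  rw [sigmaChart_algebraMap_mul_invSelf_pow]
  exact (mem_chartGrading_iff 𝒜 f w hf d b hb).mpr ⟨m, _, sigmaR_mem_reesPiece 𝒜 f w σ hσJ hp hσp hσ𝒜 hz, rfl⟩

/-- Iterates of `σʼ` on fractions. -/
theorem sigmaChart_iterate_algebraMap_mul_invSelf_pow (k : ℕ) (z : ↥(cobordantAlgebra f w)) (m : ℕ) :
    (sigmaChart 𝒜 f w d b hb σ hσJ hp hσp hσb)^[k]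
        (algebraMap _ (ChartRing 𝒜 f w d b hb) z * IsLocalization.Away.invSelf (coverElement 𝒜 f w d b hb) ^ m) =
      algebraMap _ (ChartRing 𝒜 f w d b hb) ((sigmaR σ f w hσJ hp hσp)^[k] z) *
        IsLocalization.Away.invSelf (coverElement 𝒜 f w d b hb) ^ m := by
  induction k generalizing z with
  | zero => rfl
  | succ k ih =>
    rw [Function.iterate_succ_apply, Function.iterate_succ_apply, sigmaChart_algebraMap_mul_invSelf_pow, ih]

/-- **`σʼ^[p] = id`** (given `σ^[p] = id`). [OURS · L1 W4.5c] -/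
theorem sigmaChart_iterate (y : ChartRing 𝒜 f w d b hb) :
    (sigmaChart 𝒜 f w d b hb σ hσJ hp hσp hσb)^[p] y = y := by
  obtain ⟨z, m, rfl⟩ := exists_eq_algebraMap_mul_invSelf_pow (h := coverElement 𝒜 f w d b hb) y
  rw [sigmaChart_iterate_algebraMap_mul_invSelf_pow, sigmaR_iterate_eq]

end SigmaChart

end Summit.ResolutionOfSingularities.ResolutionOfSingularities.Theorems.WildQuotientResolution.S1.CoarseChart

end
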